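import Literature.MathematicalPhysics.QuantumFieldTheory.OSPointDensities
import Literature.MathematicalPhysics.QuantumFieldTheory.OSPointGramConfig
import Literature.MathematicalPhysics.QuantumFieldTheory.OSLabelledLevelZero
import HarnessLib

/-!
# The labelled real-point data of a Schwinger family

Topic `Literature/MathematicalPhysics/QuantumFieldTheory`; support file (all proved; the chosen
densities, the real-point functions and the label class as definitions; no named facts) for the
discharge of (A1) `OS1975_exists_timeContinuation`: the third step of the instantiation of the
abstract continuation engine (`OSLabelledPieces` … `OSTemperedBound`) on an actual Schwinger family.
Osterwalder–Schrader II (Comm. Math. Phys. 42 (1975)), §IV.2 Thm. 4.1 and Ch. V (5.2)/(5.4),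
Ch. V.2 (5.17): the values `S_k(ξ; c)` of the Schwinger functions at the configurations with time
gaps `ξ` and spatial positions `c` (`pointS₀`), the labelled vectors `Ψₙ(x, ξ; a)`
(`OSPointLabelledVectors.labVec`) and the class of labels in a fixed ball (`normBall R`) satisfy the
hypotheses `IsOSLabelSet` and `IsOSLabelledRealData` of the engine: the **pointwise Gram identity**
`⟪Ψ_p(x', ξ̃; c_p…c_0), Ψ_q(x, ξ'; c_{p+1}…c_k)⟫ = S_k(…, x' + x, …; c)` ((5.2) at real times, from
(P₀) `OSPointVectors.inner_pointVector`, the configuration identity `gramConfig_labCfg` and the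
time-translation invariance of the densities), continuity in the gaps, and the bound of Thm. 4.1
(4.5) in the product form of `OSContinuationBounds.gFactor`.

## References

* K. Osterwalder, R. Schrader, *Axioms for Euclidean Green's functions II*, Comm. Math. Phys.
  42 (1975) 281–305, §IV.2 Thm. 4.1 (4.4)–(4.5); Ch. V (5.2), (5.4); Ch. V.2 (5.17). [OsterwalderSchraderCMP1975]
-/

noncomputable section

open MeasureTheory Set Filter Metric
open _root_.Topology
open scoped SchwartzMap InnerProductSpace

namespace Literature.MathematicalPhysics.QuantumFieldTheory

variable {d : ℕ} [NeZero d]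

open Literature.MathematicalPhysics.QuantumLattice (SchwingerFamily)
open Literature.MathematicalPhysics.QuantumLattice.SchwingerFamily
open Literature.MathematicalPhysics.QuantumLattice.SchwingerFamily.OSSpace
open Literature.MathematicalPhysics.QuantumFieldTheory.OSEnvelope

/-! ### Labelled configurations with increasing times -/

section Config

variable {n : ℕ}

/-- The labelled configuration has strictly increasing times for positive gaps. [folklore] -/
theorem strictMono_labCfg (a : Fin (n + 1) → EuclideanSpace ℝ (Fin d)) (x : ℝ) {ξ : Fin n → ℝ} (hξ : ∀ i, 0 < ξ i) :
    StrictMono fun j => labCfg a x ξ j 0 := by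
  refine Fin.strictMono_iff_lt_succ.2 fun j => ?_
  simp only [labCfg_apply_zero, Fin.partialSum_succ]
  linarith [hξ j]

/-- The labelled configuration lies in `incrTimes`. [folklore] -/
theorem labCfg_mem_incrTimes (a : Fin (n + 1) → EuclideanSpace ℝ (Fin d)) (x : ℝ) {ξ : Fin n → ℝ} (hξ : ∀ i, 0 < ξ i) :
    labCfg a x ξ ∈ incrTimes (n + 1) d :=
  strictMono_labCfg a x hξ

/-- Norm of the labelled configuration: `‖labCfg a 0 ξ‖ ≤ 2 sup‖aⱼ‖ + ∑ ξᵢ` (for `‖aⱼ‖ ≤ R`, `ξ > 0`). [folklore] -/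
theorem norm_labCfg_le (a : Fin (n + 1) → EuclideanSpace ℝ (Fin d)) {R : ℝ} (ha : ∀ j, ‖a j‖ ≤ R) {ξ : Fin n → ℝ}
    (hξ : ∀ i, 0 < ξ i) : ‖labCfg a 0 ξ‖ ≤ 2 * R + ∑ i, ξ i := by
  have hR : 0 ≤ R := (norm_nonneg _).trans (ha 0)
  have hsum : 0 ≤ ∑ i, ξ i := Finset.sum_nonneg fun i _ => (hξ i).le
  refine (pi_norm_le_iff_of_nonneg (by positivity)).2 fun j => ?_
  rw [labCfg]
  refine (norm_add_le _ _).trans ?_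
  have h1 : ‖(timeVec (0 + Fin.partialSum ξ j - a j 0) : EuclideanSpace ℝ (Fin d))‖ = |0 + Fin.partialSum ξ j - a j 0| := by
    rw [show (timeVec (0 + Fin.partialSum ξ j - a j 0) : EuclideanSpace ℝ (Fin d)) =
      PiLp.single 2 (0 : Fin d) (0 + Fin.partialSum ξ j - a j 0) from rfl, PiLp.norm_single, Real.norm_eq_abs]
  have h2 : |Fin.partialSum ξ j| ≤ ∑ i, ξ i := by
    rw [partialSum_eq_sum_filter, abs_of_nonneg (Finset.sum_nonneg fun i _ => (hξ i).le)]
    exact Finset.sum_le_sum_of_subset_of_nonneg (Finset.filter_subset _ _) fun i _ _ => (hξ i).le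
  have h3 : |a j 0| ≤ R := by
    have h := PiLp.norm_apply_le (a j) 0
    rw [Real.norm_eq_abs] at h
    exact h.trans (ha j)
  rw [h1]
  have h4 : |0 + Fin.partialSum ξ j - a j 0| ≤ |Fin.partialSum ξ j| + |a j 0| := by
    rw [zero_add]; exact abs_sub _ _
  linarith [ha j]

end Config

/-! ### The chosen densities and the real-point functions -/

section Data

variable {𝔖 : SchwingerFamily (EuclideanSpace ℝ (Fin d))}
  (hE1 : 𝔖.IsEuclideanCovariant) (hE2 : 𝔖.IsOSReflectionPositive) (hE0 : 𝔖.HasLinearGrowth)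

/-- **The continuous local densities of Thm. 4.1 with (4.5)** (a choice), `k' + 2` points. [cite: OsterwalderSchraderCMP1975, §IV.2 Thm. 4.1] -/
def dens (k' : ℕ) : (Fin (k' + 2) → EuclideanSpace ℝ (Fin d)) → ℂ :=
  Classical.choose (exists_isLocalDensity_tempered (k := k') 𝔖 hE1 hE2 hE0)

/-- The chosen densities are local densities. [folklore] -/
theorem isLocalDensity_dens (k' : ℕ) : IsLocalDensity 𝔖 (k' + 2) (dens hE1 hE2 hE0 k') :=
  (Classical.choose_spec (exists_isLocalDensity_tempered (k := k') 𝔖 hE1 hE2 hE0)).1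

/-- The chosen densities obey (4.5). [cite: OsterwalderSchraderCMP1975, §IV.2 Thm. 4.1 (4.5)] -/
theorem exists_bound_dens (k' : ℕ) : ∃ C : ℝ, ∃ N : ℕ, 0 ≤ C ∧ ∀ x ∈ incrTimes (k' + 2) d,
    ‖dens hE1 hE2 hE0 k' x‖ ≤ C * (1 + ‖x‖) ^ N * (1 + (minGap x)⁻¹) ^ N :=
  (Classical.choose_spec (exists_isLocalDensity_tempered (k := k') 𝔖 hE1 hE2 hE0)).2

/-- **The real-point functions** `S₀ k c Z = S_{k+1}((0, c⃗₀), (Re Z₀, c⃗₁), (Re Z₀ + Re Z₁, c⃗₂), …)`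
(`k ≥ 1` gaps; junk `0` for `k = 0`). [cite: OsterwalderSchraderCMP1975, §IV.2 (4.3)–(4.4)] -/
def pointS₀ : (k : ℕ) → (Fin (k + 1) → EuclideanSpace ℝ (Fin d)) → (Fin k → ℂ) → ℂ
  | 0, _, _ => 0
  | k' + 1, c, Z => dens hE1 hE2 hE0 k' (labCfg c 0 fun i => (Z i).re)

/-- The bound constants: `(C_{k'}, N_{k'})` chosen from (4.5). [folklore] -/
def densC (k' : ℕ) : ℝ := Classical.choose (exists_bound_dens hE1 hE2 hE0 k')

/-- The bound exponents. [folklore] -/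
def densN (k' : ℕ) : ℕ := Classical.choose (Classical.choose_spec (exists_bound_dens hE1 hE2 hE0 k'))

/-- The chosen constants bound the densities. [folklore] -/
theorem densC_spec (k' : ℕ) : 0 ≤ densC hE1 hE2 hE0 k' ∧ ∀ x ∈ incrTimes (k' + 2) d,
    ‖dens hE1 hE2 hE0 k' x‖ ≤ densC hE1 hE2 hE0 k' * (1 + ‖x‖) ^ densN hE1 hE2 hE0 k' *
      (1 + (minGap x)⁻¹) ^ densN hE1 hE2 hE0 k' :=
  Classical.choose_spec (Classical.choose_spec (exists_bound_dens hE1 hE2 hE0 k'))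

/-- **The class of labels in the ball of radius `R`.** [cite: OsterwalderSchraderCMP1975, Ch. V.2 (5.15)–(5.17)] -/
def normBall (R : ℝ) (k : ℕ) (c : Fin (k + 1) → EuclideanSpace ℝ (Fin d)) : Prop := ∀ j, ‖c j‖ ≤ R

omit [NeZero d] in
/-- The class of labels in a ball is closed under the doubling of the parts. [folklore] -/
theorem isOSLabelSet_normBall (R : ℝ) : IsOSLabelSet (normBall (d := d) R) where
  left k c p hc j := by
    rcases le_or_gt (j : ℕ) p with h | h
    · rw [dblPos_apply_of_le _ h, posRevLeft_apply]; exact hc _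
    · rw [dblPos_apply_of_lt _ h, posRevLeft_apply]; exact hc _
  right k c p hc j := by
    rcases le_or_gt (j : ℕ) (k - 1 - p) with h | h
    · rw [dblPos_apply_of_le _ h, posRight_apply]; exact hc _
    · rw [dblPos_apply_of_lt _ h, posRight_apply]; exact hc _

/-! ### The product form of the bound -/

/-- `1 + r ≤ 2 (r + r⁻¹)` for `r > 0`. [folklore] -/
theorem one_add_le_two_mul_add_inv {r : ℝ} (hr : 0 < r) : 1 + r ≤ 2 * (r + r⁻¹) := by
  rcases le_or_gt 1 r with h | h
  · have : 0 < r⁻¹ := inv_pos.2 hr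
    linarith
  · have : 1 < r⁻¹ := one_lt_inv_iff₀.2 ⟨hr, h⟩
    linarith

/-- `1 + ∑_{i∈s} fᵢ ≤ ∏_{i∈s} (1 + fᵢ)` for `f ≥ 0`. [folklore] -/
theorem one_add_sum_le_prod_one_add {ι : Type*} [DecidableEq ι] (s : Finset ι) {f : ι → ℝ} (hf : ∀ i, 0 ≤ f i) :
    1 + ∑ i ∈ s, f i ≤ ∏ i ∈ s, (1 + f i) := by
  induction s using Finset.induction_on with
  | empty => simp
  | insert a s ha ih =>
    rw [Finset.sum_insert ha, Finset.prod_insert ha]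
    have hP : 1 ≤ ∏ i ∈ s, (1 + f i) := by
      have h0 : (0 : ℝ) ≤ ∑ i ∈ s, f i := Finset.sum_nonneg fun i _ => hf i
      linarith
    have ha0 := hf a
    nlinarith

/-- `1 + ∑ ρᵢ ≤ 2ᵏ Π(ρ)` for `ρ > 0`. [folklore] -/
theorem one_add_sum_le_gFactor {k : ℕ} {ρ : Fin k → ℝ} (hρ : ∀ i, 0 < ρ i) :
    1 + ∑ i, ρ i ≤ (2 : ℝ) ^ k * gFactor (fun i => (ρ i : ℂ)) := by
  calc 1 + ∑ i, ρ i ≤ ∏ i, (1 + ρ i) := one_add_sum_le_prod_one_add _ fun i => (hρ i).le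
    _ ≤ ∏ i, (2 * (ρ i + (ρ i)⁻¹)) := Finset.prod_le_prod (fun i _ => by linarith [hρ i]) fun i _ =>
        one_add_le_two_mul_add_inv (hρ i)
    _ = (2 : ℝ) ^ k * gFactor (fun i => (ρ i : ℂ)) := by
        rw [Finset.prod_mul_distrib, Finset.prod_const, Finset.card_univ, Fintype.card_fin, gFactor]
        congr 1
        refine Finset.prod_congr rfl fun i _ => ?_
        rw [Complex.norm_real, Real.norm_eq_abs, abs_of_pos (hρ i)]

end Data

/-! ### The labelled real-point data -/

section RealData

variable {𝔖 : SchwingerFamily (EuclideanSpace ℝ (Fin d))}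
  (hE1 : 𝔖.IsEuclideanCovariant) (hE2 : 𝔖.IsOSReflectionPositive) (hE0 : 𝔖.HasLinearGrowth)

/-- `1 + ∑ ρᵢ⁻¹ ≤ 2ᵏ Π(ρ)` for `ρ > 0`. [folklore] -/
theorem one_add_sum_inv_le_gFactor {k : ℕ} {ρ : Fin k → ℝ} (hρ : ∀ i, 0 < ρ i) :
    1 + ∑ i, (ρ i)⁻¹ ≤ (2 : ℝ) ^ k * gFactor (fun i => (ρ i : ℂ)) := by
  calc 1 + ∑ i, (ρ i)⁻¹ ≤ ∏ i, (1 + (ρ i)⁻¹) := one_add_sum_le_prod_one_add _ fun i => (inv_pos.2 (hρ i)).le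
    _ ≤ ∏ i, (2 * (ρ i + (ρ i)⁻¹)) := Finset.prod_le_prod (fun i _ => by have := inv_pos.2 (hρ i); linarith) fun i _ => by
        have h := one_add_le_two_mul_add_inv (inv_pos.2 (hρ i))
        rwa [inv_inv, add_comm (ρ i)⁻¹] at h
    _ = (2 : ℝ) ^ k * gFactor (fun i => (ρ i : ℂ)) := by
        rw [Finset.prod_mul_distrib, Finset.prod_const, Finset.card_univ, Fintype.card_fin, gFactor]
        congr 1
        refine Finset.prod_congr rfl fun i _ => ?_
        rw [Complex.norm_real, Real.norm_eq_abs, abs_of_pos (hρ i)]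

/-- The gaps of `labCfg c 0 ρ` are `ρ`. [folklore] -/
theorem labCfg_gap {k' : ℕ} (c : Fin (k' + 1 + 1) → EuclideanSpace ℝ (Fin d)) (ρ : Fin (k' + 1) → ℝ) (i : Fin (k' + 1)) :
    labCfg c 0 ρ i.succ 0 - labCfg c 0 ρ (Fin.castSucc i) 0 = ρ i := by
  rw [labCfg_apply_zero, labCfg_apply_zero, Fin.partialSum_succ]; ring

/-- The minimal gap of `labCfg c 0 ρ`: `(minGap)⁻¹ ≤ ∑ ρᵢ⁻¹`. [folklore] -/
theorem inv_minGap_labCfg_le {k' : ℕ} (c : Fin (k' + 1 + 1) → EuclideanSpace ℝ (Fin d)) {ρ : Fin (k' + 1) → ℝ}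
    (hρ : ∀ i, 0 < ρ i) : (minGap (labCfg c 0 ρ))⁻¹ ≤ ∑ i, (ρ i)⁻¹ := by
  obtain ⟨i₀, -, hi₀⟩ := Finset.exists_mem_eq_inf' Finset.univ_nonempty
    (fun i : Fin (k' + 1) => labCfg c 0 ρ i.succ 0 - labCfg c 0 ρ (Fin.castSucc i) 0)
  have hmin : minGap (labCfg c 0 ρ) = ρ i₀ := by rw [minGap, hi₀, labCfg_gap]
  rw [hmin]
  exact Finset.single_le_sum (f := fun i => (ρ i)⁻¹) (fun i _ => (inv_pos.2 (hρ i)).le) (Finset.mem_univ i₀)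

/-- **The bound constants** `C₀ k`. [folklore] -/
def pointC₀ (R : ℝ) : ℕ → ℝ
  | 0 => 0
  | k' + 1 => densC hE1 hE2 hE0 k' * (1 + 2 * |R|) ^ densN hE1 hE2 hE0 k' * (4 : ℝ) ^ ((k' + 1) * densN hE1 hE2 hE0 k')

/-- **The bound exponents** `p₀ k`. [folklore] -/
def pointp₀ : ℕ → ℕ
  | 0 => 0
  | k' + 1 => 2 * densN hE1 hE2 hE0 k'

/-- **The bound (4.5) in product form**: for labels in the ball of radius `R` and positive gaps,
`‖S₀ (k'+1) c ρ‖ ≤ C₀ (k'+1) · Π(ρ)^{p₀ (k'+1)}`. [cite: OsterwalderSchraderCMP1975, §IV.2 Thm. 4.1 (4.5)] -/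
theorem norm_pointS₀_le {R : ℝ} {k' : ℕ} {c : Fin (k' + 1 + 1) → EuclideanSpace ℝ (Fin d)} (hc : normBall R (k' + 1) c)
    {ρ : Fin (k' + 1) → ℝ} (hρ : ∀ i, 0 < ρ i) :
    ‖pointS₀ hE1 hE2 hE0 (k' + 1) c (fun i => (ρ i : ℂ))‖ ≤
      pointC₀ hE1 hE2 hE0 R (k' + 1) * gFactor (fun i => (ρ i : ℂ)) ^ pointp₀ hE1 hE2 hE0 (k' + 1) := by
  obtain ⟨hC, hb⟩ := densC_spec hE1 hE2 hE0 k'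
  set C := densC hE1 hE2 hE0 k'
  set N := densN hE1 hE2 hE0 k'
  set G : ℝ := gFactor (fun i => (ρ i : ℂ)) with hG
  have hG0 : 0 ≤ G := by rw [hG, gFactor]; exact Finset.prod_nonneg fun i _ => by positivity
  have hre : (fun i => ((ρ i : ℂ)).re) = ρ := funext fun i => Complex.ofReal_re _
  have hx : labCfg c 0 ρ ∈ incrTimes (k' + 2) d := labCfg_mem_incrTimes c 0 hρ
  have h := hb _ hx
  simp only [pointS₀, hre]
  -- the two factors
  have hR : ∀ j, ‖c j‖ ≤ |R| := fun j => (hc j).trans (le_abs_self R)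
  have h1 : 1 + ‖labCfg c 0 ρ‖ ≤ (1 + 2 * |R|) * ((2 : ℝ) ^ (k' + 1) * G) := by
    have hn := norm_labCfg_le c hR hρ
    have hs := one_add_sum_le_gFactor hρ
    have hsum : 0 ≤ ∑ i, ρ i := Finset.sum_nonneg fun i _ => (hρ i).le
    have habs : 0 ≤ |R| := abs_nonneg R
    nlinarith
  have h2 : 1 + (minGap (labCfg c 0 ρ))⁻¹ ≤ (2 : ℝ) ^ (k' + 1) * G := by
    have := inv_minGap_labCfg_le c hρ
    have := one_add_sum_inv_le_gFactor hρ
    linarith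
  have hm0 : 0 ≤ 1 + (minGap (labCfg c 0 ρ))⁻¹ := by
    have : 0 < minGap (labCfg c 0 ρ) := minGap_pos (by rw [orderedRegion_eq_incrTimes]; exact hx)
    positivity
  calc ‖dens hE1 hE2 hE0 k' (labCfg c 0 ρ)‖ ≤ C * (1 + ‖labCfg c 0 ρ‖) ^ N * (1 + (minGap (labCfg c 0 ρ))⁻¹) ^ N := h
    _ ≤ C * ((1 + 2 * |R|) * ((2 : ℝ) ^ (k' + 1) * G)) ^ N * ((2 : ℝ) ^ (k' + 1) * G) ^ N := by
        gcongr
    _ = C * (1 + 2 * |R|) ^ N * (4 : ℝ) ^ ((k' + 1) * N) * G ^ (2 * N) := by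
        rw [show (4 : ℝ) = 2 ^ 2 by norm_num, ← pow_mul, mul_pow, mul_pow, ← pow_mul]
        ring
    _ = pointC₀ hE1 hE2 hE0 R (k' + 1) * G ^ pointp₀ hE1 hE2 hE0 (k' + 1) := by
        simp only [pointC₀, pointp₀]; rfl

/-- **The labelled real-point data of a Schwinger family satisfy the hypotheses of the engine**:
the pointwise Gram identity (5.2) at real times, continuity in the gaps, and the bound (4.5). [cite: OsterwalderSchraderCMP1975, §IV.2 Thm. 4.1, Ch. V (5.2), Ch. V.2 (5.17)] -/
theorem isOSLabelledRealData_point (R : ℝ) :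
    IsOSLabelledRealData (H := OSHilbert 𝔖 hE2) (normBall R) (pointS₀ hE1 hE2 hE0) (labVec hE2)
      (pointC₀ hE1 hE2 hE0 R) (pointp₀ hE1 hE2 hE0) where
  gram k c p ρ hρ x' x hx' hx hsum := by
    cases k with
    | zero => exact p.elim0
    | succ k' =>
      -- the two labelled configurations are positive-time ordered
      have hL : ∀ i, 0 < blockRevLeft ρ p i := fun i => hρ _
      have hRt : ∀ i, 0 < blockRight ρ p i := fun i => hρ _
      have hXL := posOrdered_labCfg (posRevLeft c p) hx' hL
      have hXR := posOrdered_labCfg (posRight c p) hx hRt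
      simp only [labVec]
      rw [pointVec_eq hE2 hXL, pointVec_eq hE2 hXR]
      -- the transported density of order `p + 1 + (k' + 1 - 1 - p + 1)`
      have h : (p : ℕ) + 1 + (k' + 1 - 1 - p + 1) = k' + 2 := by have := p.2; omega
      have hD := (isLocalDensity_dens hE1 hE2 hE0 k').transport h
      rw [inner_pointVector hE2 hE1 hE0 hXL hXR hD.cont hD.rep']
      -- the configuration identity and translation invariance
      have hcfg : (fun i => gramConfig (labCfg (posRevLeft c p) x' (blockRevLeft ρ p))
          (labCfg (posRight c p) x (blockRight ρ p)) (Fin.cast h.symm i)) =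
          fun i => labCfg c 0 ρ i + timeVec (-(x' + Fin.partialSum ρ ⟨p, by omega⟩)) := by
        funext i
        rw [gramConfig_labCfg c p ρ hsum]
        congr 2
      have hre : (fun i => ((ρ i : ℂ)).re) = ρ := funext fun i => Complex.ofReal_re _
      simp only [pointS₀, hre]
      rw [hcfg, (isLocalDensity_dens hE1 hE2 hE0 k').add_timeVec hE1 _ (labCfg_mem_incrTimes c 0 hρ)]
  cont k c _ := by
    cases k with
    | zero => exact continuousOn_const
    | succ k' =>
      have hre : ∀ ρ : Fin (k' + 1) → ℝ, (fun i => ((ρ i : ℂ)).re) = ρ := fun ρ => funext fun i => Complex.ofReal_re _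
      simp only [pointS₀, hre]
      exact (isLocalDensity_dens hE1 hE2 hE0 k').cont.comp (continuous_labCfg c 0).continuousOn
        fun ρ hρ => labCfg_mem_incrTimes c 0 hρ
  C₀_nonneg k := by
    cases k with
    | zero => exact le_rfl
    | succ k' =>
      simp only [pointC₀]
      have := (densC_spec hE1 hE2 hE0 k').1
      positivity
  bound k c hc ρ hρ := by
    cases k with
    | zero => simp [pointS₀, pointC₀]
    | succ k' => exact norm_pointS₀_le hE1 hE2 hE0 hc hρ

end RealData

end Literature.MathematicalPhysics.QuantumFieldTheory
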